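import Summits.ResolutionOfSingularities.ResolutionOfSingularities.Theorems.FrobeniusClosingPatchingRelPerfectTwoPlanesLevelTwo
import Summits.ResolutionOfSingularities.ResolutionOfSingularities.Theorems.FrobeniusClosingPatchingRelPerfectTwoPlanesLevelTwoS
import Summits.ResolutionOfSingularities.ResolutionOfSingularities.Theorems.FrobeniusClosingPatchingRelPerfectTwoPlanesCharts
import Summits.ResolutionOfSingularities.ResolutionOfSingularities.Theorems.FrobeniusClosingPatchingRelPerfectConeCubeSide
import HarnessLib

/-!
# Crux `PatchingRelPerfect` (stmt-ResolutionOfSingularities-16161), chain w52 — the rank-two member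
# `f = x₀x₁ + x₂³`: the charts `B_i`, `i ≠ 0`, of `Bl_𝔪` — the PLANE step `Bl_{(u, e₀)}` assembled

[OURS · L1 W5.2 · rung, DESIGN STAGE → assembly brick] On a chart `B_i` (`i ≠ 0`) of `Bl_𝔪 Spec S`
the companion factors of the design note NEXT-two-planes-cube.md map to (`…TwoPlanesCharts`)
`𝔪ᴺ · A · A₃ · A₄ · I ↦ (u)^{N+8} · (e₀, u) · J_i`,
`J_i = (e₀e₁, u) · ((H♯) + u(e₀) + (u²)) · ((H♯) + (u²))`, `H♯ = e₀e₁ + u e₂³`, so that — after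
twisting off `(u)^{N+8}` (Stacks 080B) — a blowing up along the image is a blowing up of the PLANE
blow-up `Bl_{(u, e₀)} Spec B_i` along `J_i` (Stacks 080A, `isRegular_of_isBlowup_mul_of_charts`), whose
two charts are resolved by `…TwoPlanesLevelTwo` (`t`-chart) and `…TwoPlanesLevelTwoS` (`s`-chart).
PROVED here: this assembly, `isRegular_of_isBlowup_tpPlane`, with the chart-coordinate facts it
consumes kept as EXPLICIT hypotheses (to be discharged from the polynomial models
`chartStageEquiv` / `chartQuotEquiv` in the instance files): integrality of `B_i/(u, e₀)`,
`B_i/(e₁)`, `B_i/(u, e₀, e₁)`, `B_i/(u, e₁)` (and its regularity), the non-memberships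
`e₁ ∉ (u, e₀)`, `e₀ ∉ (e₁)`, `e₀ ∉ (u) + (e₁)`, and the five exceptional-curve facts
`hPd hPr hPX hQr hQ0` of the two level-two files.  Unconditional inside: `(u, e₀)` quasi-regular,
`B_i` and `B_i/(u, e₀)` regular, `B_i`, `B_i/(u)` domains, `e₀ ∉ (u)`.

* `span_range_plane`, `tp_all_product`, `map_tpAll` — the image in the form `(u^{N+8}) · (J_i · (u, e₀))`;
* `tpPlane_chart_zero`, `tpPlane_chart_succ` — the two charts of the plane blow-up, instantiated;
* `isRegular_of_isBlowup_tpPlane_core`, `isRegular_of_isBlowup_tpPlane`.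

Nothing here is a statement of the manuscript under review.

## References

* The Stacks Project, Tags 080A, 080B, 0804, 0BIQ. [StacksProject]
* Q. Liu, *Algebraic Geometry and Arithmetic Curves*, OUP 2002, Thm. 8.1.19 (a). [Liu2002]
-/

-- `Summit.<Summit>.<Sub>.Theorems` with `Sub = Summit` (single-conjunct summit, D-0017)
set_option linter.dupNamespace false

noncomputable section

open CategoryTheory CategoryTheory.Limits AlgebraicGeometry Literature.AlgebraicGeometry.Resolution
open IsLocalRing

namespace Summit.ResolutionOfSingularities.ResolutionOfSingularities.Theorems

namespace TwoPlanesRung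

open ConeRung

universe u

/-- Reordering the five twisted factors of a chart `B_i`, `i ≠ 0`. [folklore] -/
theorem tp_all_product {B : Type*} [CommRing B] (W P X1 X2 X3 : Ideal B) (N : ℕ) :
    W ^ N * (W ^ 2 * P) * (W ^ 2 * X1) * (W ^ 2 * X2) * (W ^ 2 * X3) =
      W ^ (N + 8) * (X1 * X2 * X3 * P) := by
  ring

section Plane

variable {S : Type u} [CommRing S] [IsRegularLocalRing S] (x : Fin 4 → S)
  (hx : Ideal.span (Set.range x) = IsLocalRing.maximalIdeal S)
  (hd : (IsLocalRing.maximalIdeal S).spanFinrank = 4) (i : Fin 4)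

local notation3 "M" => Ideal.span (Set.range x)
local notation3 "fT" => x 0 * x 1 + x 2 ^ 3
local notation3 "B" => chartRing x i
local notation3 "φ" => chartBase x i
local notation3 "uB" => chartBase x i (x i)
local notation3 "e[" j "]" => chartGen x i j
/-- the strict transform `H♯ = e₀e₁ + u e₂³` of `f` -/
local notation3 (prettyPrint := false) "Hs" => chartGen x i 0 * chartGen x i 1 + chartBase x i (x i) * chartGen x i 2 ^ 3
local notation3 "U" => Ideal.span {chartBase x i (x i)}
/-- the plane centre `(u, e₀)` as a chart family and its ideal -/
local notation3 (prettyPrint := false) "cc" => (Fin.cons (chartBase x i (x i)) (fun _ : Fin 1 => chartGen x i 0) : Fin 2 → chartRing x i)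
local notation3 (prettyPrint := false) "II" => Ideal.span (Set.range
  (Fin.cons (chartBase x i (x i)) (fun _ : Fin 1 => chartGen x i 0) : Fin 2 → chartRing x i))
/-- the three later companion factors on `B_i` (divided by `u²` each) -/
local notation3 (prettyPrint := false) "J" => Ideal.span {chartGen x i 0 * chartGen x i 1, chartBase x i (x i)} *
    (Ideal.span {chartGen x i 0 * chartGen x i 1 + chartBase x i (x i) * chartGen x i 2 ^ 3} ⊔
      Ideal.span {chartBase x i (x i)} * Ideal.span {chartGen x i 0} ⊔ Ideal.span {chartBase x i (x i)} ^ 2) *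
    (Ideal.span {chartGen x i 0 * chartGen x i 1 + chartBase x i (x i) * chartGen x i 2 ^ 3} ⊔
      Ideal.span {chartBase x i (x i)} ^ 2)
/-- the exceptional-curve models of the two level-two charts -/
local notation3 (prettyPrint := false) "PP" => MvPolynomial {j : Fin 2 // j ≠ Fin.succ 0} (chartRing x i ⧸ II)
local notation3 (prettyPrint := false) "gFlat" => (MvPolynomial.C (Ideal.Quotient.mk II (chartGen x i 1)) :
    MvPolynomial {j : Fin 2 // j ≠ Fin.succ 0} (chartRing x i ⧸ II))
  + MvPolynomial.X (⟨0, (Fin.succ_ne_zero 0).symm⟩ : {j : Fin 2 // j ≠ Fin.succ 0}) *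
    MvPolynomial.C (Ideal.Quotient.mk II (chartGen x i 2 ^ 3))
local notation3 (prettyPrint := false) "XFlat" => (MvPolynomial.X (⟨0, (Fin.succ_ne_zero 0).symm⟩ : {j : Fin 2 // j ≠ Fin.succ 0}) :
  MvPolynomial {j : Fin 2 // j ≠ Fin.succ 0} (chartRing x i ⧸ II))
local notation3 (prettyPrint := false) "PP₀" => MvPolynomial {j : Fin 2 // j ≠ 0} (chartRing x i ⧸ II)
local notation3 (prettyPrint := false) "hFlat" => MvPolynomial.X (⟨1, one_ne_zero_fin2⟩ : {j : Fin 2 // j ≠ 0}) *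
    (MvPolynomial.C (Ideal.Quotient.mk II (chartGen x i 1)) : MvPolynomial {j : Fin 2 // j ≠ 0} (chartRing x i ⧸ II))
  + MvPolynomial.C (Ideal.Quotient.mk II (chartGen x i 2 ^ 3))

omit [IsRegularLocalRing S] in
/-- The plane-centre ideal: `((u, e₀) as a family) = (e₀, u)`. [folklore] -/
theorem span_range_plane : II = Ideal.span {e[0], uB} := by
  rw [Fin.range_cons, Set.range_const, Ideal.span_pair_comm]

omit [IsRegularLocalRing S] in
/-- **`𝔪ᴺ · A · A₃ · A₄ · I ↦ (u^{N+8}) · (J_i · (u, e₀))`** on `B_i`. [cite: StacksProject, Tag 080B] -/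
theorem map_tpAll (N : ℕ) :
    (M ^ N * (Ideal.span {fT} ⊔ Ideal.span {x 0} * M ⊔ M ^ 3) * (Ideal.span {fT} ⊔ M ^ 3) *
        (Ideal.span {fT} ⊔ Ideal.span {x 0} * M ^ 2 ⊔ M ^ 4) * (Ideal.span {fT} ⊔ M ^ 4)).map φ =
      Ideal.span {uB ^ (N + 8)} * (J * II) := by
  rw [Ideal.map_mul, Ideal.map_mul, Ideal.map_mul, Ideal.map_mul, Ideal.map_pow,
    ConeRung.map_chartBase_M, map_chartBase_tpA, map_chartBase_tpA3, map_chartBase_tpA4,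
    map_chartBase_tpI, span_range_plane, ← Ideal.span_singleton_pow]
  exact tp_all_product U (Ideal.span {e[0], uB}) _ _ _ N

omit [IsRegularLocalRing S] in
/-- The `s`-chart (`k = 0`) of the plane blow-up on `B_i`: `…TwoPlanesLevelTwoS` instantiated.
[cite: StacksProject, Tag 080A] -/
theorem tpPlane_chart_zero (hc : IsQuasiRegular cc) (hB : IsDomain B) (hBr : IsRegularRing B)
    (hdII : IsDomain (B ⧸ II)) (hrII : IsRegularRing (B ⧸ II)) (hu0 : uB ≠ 0)
    (hQr : IsRegularRing (PP₀ ⧸ Ideal.span {hFlat})) (hQ0 : hFlat ≠ 0)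
    {Y' : Scheme.{u}} {ρ' : Y' ⟶ Spec (.of (chartRing cc 0))}
    (h' : IsBlowup ρ' (affineBlowup.idealSheaf ((J).map (chartBase cc 0)))) : Scheme.IsRegular Y' := by
  haveI := hB; haveI := hBr; haveI := hdII; haveI := hrII
  exact isRegular_of_isBlowup_tpProd_s uB e[0] e[1] (e[2] ^ 3) hc hu0 hQr hQ0 h'

omit [IsRegularLocalRing S] in
/-- The `t`-chart (`k = 1`) of the plane blow-up on `B_i`: `…TwoPlanesLevelTwo` instantiated.
[cite: StacksProject, Tag 080A] -/
theorem tpPlane_chart_succ (hc : IsQuasiRegular cc) (hB : IsDomain B) (hBr : IsRegularRing B)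
    (hdII : IsDomain (B ⧸ II)) (hrII : IsRegularRing (B ⧸ II)) (hdu : IsDomain (B ⧸ U))
    (hdy1 : IsDomain (B ⧸ Ideal.span {e[1]})) (hdIIy : IsDomain (B ⧸ (II ⊔ Ideal.span {e[1]})))
    (hdy : IsDomain (B ⧸ Ideal.span {uB, e[1]})) (hry : IsRegularRing (B ⧸ Ideal.span {uB, e[1]}))
    (hy : e[1] ∉ II) (hey : e[0] ∉ Ideal.span {e[1]}) (he : e[0] ∉ U) (heuy : e[0] ∉ U ⊔ Ideal.span {e[1]})
    (hPd : IsDomain (PP ⧸ Ideal.span {gFlat})) (hPr : IsRegularRing (PP ⧸ Ideal.span {gFlat}))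
    (hPX : XFlat ∉ Ideal.span {gFlat})
    {Y' : Scheme.{u}} {ρ' : Y' ⟶ Spec (.of (chartRing cc (Fin.succ 0)))}
    (h' : IsBlowup ρ' (affineBlowup.idealSheaf ((J).map (chartBase cc (Fin.succ 0))))) :
    Scheme.IsRegular Y' := by
  haveI := hB; haveI := hBr; haveI := hdII; haveI := hrII; haveI := hdu; haveI := hdy1; haveI := hdIIy
  exact isRegular_of_isBlowup_tpProd_t uB e[0] e[1] (e[2] ^ 3) hc hdy hry hy hey he heuy hPd hPr hPX h'

set_option maxHeartbeats 400000 in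
include hx hd in
/-- **The plane step on `B_i`, `i ≠ 0` — core form**: every blowing up of `Spec B_i` along
`(u^{N+8}) · (J_i · (u, e₀))` is regular, given the chart-coordinate facts (hypotheses): twist off the
Cartier factor, pass to `Bl_{(u,e₀)} Spec B_i` (`isRegular_of_isBlowup_mul_of_charts`) and use the two
chart instantiations. [cite: StacksProject, Tag 080A] [cite: StacksProject, Tag 080B] -/
theorem isRegular_of_isBlowup_tpPlane_core (hi : i ≠ 0) (N : ℕ)
    (hdII : IsDomain (B ⧸ II)) (hdy1 : IsDomain (B ⧸ Ideal.span {e[1]}))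
    (hdIIy : IsDomain (B ⧸ (II ⊔ Ideal.span {e[1]})))
    (hdy : IsDomain (B ⧸ Ideal.span {uB, e[1]})) (hry : IsRegularRing (B ⧸ Ideal.span {uB, e[1]}))
    (hy : e[1] ∉ II) (hey : e[0] ∉ Ideal.span {e[1]}) (heuy : e[0] ∉ U ⊔ Ideal.span {e[1]})
    (hPd : IsDomain (PP ⧸ Ideal.span {gFlat})) (hPr : IsRegularRing (PP ⧸ Ideal.span {gFlat}))
    (hPX : XFlat ∉ Ideal.span {gFlat})
    (hQr : IsRegularRing (PP₀ ⧸ Ideal.span {hFlat})) (hQ0 : hFlat ≠ 0)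
    {Y : Scheme.{u}} {ρ : Y ⟶ Spec (.of B)}
    (hρ : IsBlowup ρ (affineBlowup.idealSheaf (Ideal.span {uB ^ (N + 8)} * (J * II)))) :
    Scheme.IsRegular Y := by
  haveI : IsDomain S := isDomain_of_isRegularLocalRing S
  have hqr := isQuasiRegular_regularSystemOfParameters hd x hx
  have hBr : IsRegularRing B := isRegularRing_chart x hx hd i
  haveI := isRegularRing_residue x hx
  haveI := isDomain_residue x hx
  have hxi : x i ≠ 0 := (isRsopPart_comp_of_rsop hd x hx id Function.injective_id).ne_zero i
  have hB : IsDomain B := isDomain_chartRing x i hxi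
  have hdu : IsDomain (B ⧸ U) := isDomain_chartRing_quot_span x i hqr
  have hi0 : (0 : Fin 4) ≠ i := fun h => hi h.symm
  have hc : IsQuasiRegular cc :=
    isQuasiRegular_cons_chartGen x i (fun _ : Fin 1 => (⟨0, hi0⟩ : {j : Fin 4 // j ≠ i})) hqr
      (Function.injective_of_subsingleton _)
  have hrII : IsRegularRing (B ⧸ II) :=
    isRegularRing_quot_cons_chartGen x i (fun _ : Fin 1 => (⟨0, hi0⟩ : {j : Fin 4 // j ≠ i})) hqr
  have he : e[0] ∉ U := chartGen_notMem_span_u x hx hd i 0 hi0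
  have hu : uB ∈ nonZeroDivisors B :=
    reesChartBase_mem_nonZeroDivisors (x i) (Ideal.mem_span_range_self (f := x) (x := i))
  have hu0 : uB ≠ 0 := nonZeroDivisors.ne_zero hu
  have h0 := fun (Y' : Scheme.{u}) (ρ' : Y' ⟶ Spec (.of (chartRing cc 0)))
      (h' : IsBlowup ρ' (affineBlowup.idealSheaf ((J).map (chartBase cc 0)))) =>
    tpPlane_chart_zero x i hc hB hBr hdII hrII hu0 hQr hQ0 h'
  have h1 := fun (Y' : Scheme.{u}) (ρ' : Y' ⟶ Spec (.of (chartRing cc (Fin.succ 0))))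
      (h' : IsBlowup ρ' (affineBlowup.idealSheaf ((J).map (chartBase cc (Fin.succ 0))))) =>
    tpPlane_chart_succ x i hc hB hBr hdII hrII hdu hdy1 hdIIy hdy hry hy hey he heuy hPd hPr hPX h'
  have hcharts : ∀ (k : Fin 2) (Y' : Scheme.{u}) (ρ' : Y' ⟶ Spec (.of (chartRing cc k))),
      IsBlowup ρ' (affineBlowup.idealSheaf ((J).map (chartBase cc k))) → Scheme.IsRegular Y' :=
    Fin.forall_fin_two.mpr ⟨h0, h1⟩
  exact CoreRungTower.isRegular_of_isBlowup_span_singleton_mul (pow_mem hu (N + 8)) _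
    (fun Y' ρ' h' => isRegular_of_isBlowup_mul_of_charts cc J hcharts h') hρ

include hx hd in
/-- **The plane step on `B_i`, `i ≠ 0`, assembled** (member form of the hypothesis): every blowing up
of `Spec B_i` along the image of `𝔪ᴺ · A · A₃ · A₄ · I` is regular, given the chart-coordinate facts.
[cite: StacksProject, Tag 080A] [cite: StacksProject, Tag 080B] [cite: Liu2002, Thm. 8.1.19 (a)] -/
theorem isRegular_of_isBlowup_tpPlane (hi : i ≠ 0) (N : ℕ)
    (hdII : IsDomain (B ⧸ II)) (hdy1 : IsDomain (B ⧸ Ideal.span {e[1]}))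
    (hdIIy : IsDomain (B ⧸ (II ⊔ Ideal.span {e[1]})))
    (hdy : IsDomain (B ⧸ Ideal.span {uB, e[1]})) (hry : IsRegularRing (B ⧸ Ideal.span {uB, e[1]}))
    (hy : e[1] ∉ II) (hey : e[0] ∉ Ideal.span {e[1]}) (heuy : e[0] ∉ U ⊔ Ideal.span {e[1]})
    (hPd : IsDomain (PP ⧸ Ideal.span {gFlat})) (hPr : IsRegularRing (PP ⧸ Ideal.span {gFlat}))
    (hPX : XFlat ∉ Ideal.span {gFlat})
    (hQr : IsRegularRing (PP₀ ⧸ Ideal.span {hFlat})) (hQ0 : hFlat ≠ 0)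
    {Y : Scheme.{u}} {ρ : Y ⟶ Spec (.of B)}
    (hρ : IsBlowup ρ (affineBlowup.idealSheaf
      ((M ^ N * (Ideal.span {fT} ⊔ Ideal.span {x 0} * M ⊔ M ^ 3) * (Ideal.span {fT} ⊔ M ^ 3) *
        (Ideal.span {fT} ⊔ Ideal.span {x 0} * M ^ 2 ⊔ M ^ 4) * (Ideal.span {fT} ⊔ M ^ 4)).map φ))) :
    Scheme.IsRegular Y :=
  isRegular_of_isBlowup_tpPlane_core x hx hd i hi N hdII hdy1 hdIIy hdy hry hy hey heuy hPd hPr hPX hQr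
    hQ0 (by rw [map_tpAll] at hρ; exact hρ)

end Plane

end TwoPlanesRung

end Summit.ResolutionOfSingularities.ResolutionOfSingularities.Theorems

end
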